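import Summits.QuantumFields.BalabanUV.Beta.EriceRemainderEnclosureHistoryAutonomyComparisonAgeCompositionNestedYoungPair

/-!
# EriceRemainderEnclosureHistoryAutonomyComparisonAgeCompositionNestedYoungPairTails — (E92e) route (N), first order: EVERY OLD TAIL OF THE CENSUS THREE
# AGES FROM `k₂ ≥ 14`, RATIONAL INSTANCES OF (E92d).  (E92d) `flow_nonneg_census_three_ages_young_pair` closes the END along every flow for the census
# three ages `{1, k₂, k₃}` from ONE displayed inequality `2√2·Q·(1∕k₂ + 1∕k₃) + (k₂+1)∕k₃ ≤ (1 − √2∕2)²`, `Q = Q(p₀)` the young-pair slack,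
# `p₀⁴(k₂+1) ≤ 2`.  Here: `Q(p₀) ≤ Q_U` from rational data (`√2 ≤ 99∕70`), the displayed inequality from `K_lo ≤ k₂ ≤ K_hi`, `k₃ ≥ T` and one decimal
# check, and the four instances `14 ≤ k₂ ≤ 29 ∧ k₃ ≥ 1500`, `30 ≤ k₂ ≤ 66 ∧ k₃ ≥ 1600`, `67 ≤ k₂ ≤ 100 ∧ k₃ ≥ 1800`, `101 ≤ k₂ ≤ 229 ∧ k₃ ≥ 3600`.  With
# (E92c) `flow_nonneg_census_three_ages_old_middle` (`k₂ ≥ 230`: every `k₃`) and (E92b) `flow_nonneg_three_ages_young_pair` (R2, `k₂ ≤ 66`; for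
# `k₂ ≤ 13` it starts below `k₃ = 1050`) EVERY TAIL `k₃ → ∞` of the census three ages is typed: what is left of «three ages at every ratio» is a
# BOUNDED set of `(k₂, k₃)` (README g83∕e92 §3: `k₂ ≤ 228`, `k₃ ≤ 3599`, ≈ 1.5·10⁵ cells, all inside the numerically safe mass region `k₃ ≲ 5·10³`)

Cell `pub-balaban`, β-function sub-cell, BINDER row D4 «RemainderConst leaves for Bałaban's split» (`HOME/BINDER-OWNERS.md`; owner lineage `b2b-balaban-beta-an4`;
this file by co-owner #2 lineage `b2b-balaban-beta-d4-p2`, generation 83), β-FLOW TEAM duty (1), FREEZE (0) honoured (def-free; nothing restated).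

HONEST FRAMING (page 1, verbatim and binding).  *"Discharging BetaPertH makes Bałaban's UV stability UNCONDITIONAL — a real constructive-QFT result; it is
NOT the continuum limit and NOT the Clay problem."*  THIS FILE DISCHARGES NOTHING OF THE KIND.  Elementary real algebra ∕ real analysis about ABSTRACT
functionals on a box ]0,γ]^ℕ with displayed floors, profiles and signs, and the FIRST-ORDER renewal objects of route (N) built from them — hypotheses of a
census, not facts; the form, signs, ages and moments of Bałaban's (1.22) limit functional are NOT PRINTED ([I] p. 298; GAPS G-t4-U2-1∕-2) and NOT asserted.
Row D4 class UNCHANGED (critical-path width 0; instance 0∕1; D4 DISCHARGE NO DATE).  HONEST DEPENDENCY: continuum YM on T⁴ ⇐ BetaPertH ∧ nine spine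
estimates (0/9 proved); BetaPertH ⇐ (D1) ∧ (D4) ∧ CAP+tail; G-an2-4 gates asym, D1 and NE2/3/4.

THE NUMBERS (README `HOME/b2b-balaban-beta-d4-p2/g83/e92/README.md` §2(d)).  `Q(p₀) = √2(1−p₀)∕(2(1+p₀) − √2(1−p₀))`; instance A: `p₀ = 0.375`
(`0.375⁴·101 ≤ 2`), `Q ≤ 0.475`, check `2·(99∕70)·0.475·(1∕67 + 1∕1800) + 101∕1800 = 0.0769 ≤ (41∕140)² = 0.0858`; B: `p₀ = 0.4156`, `Q ≤ 0.414`,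
`0.0816`; C: `p₀ = 0.508`, `Q ≤ 0.301`, `0.0814`; D: `p₀ = 0.3053`, `Q ≤ 0.605`, `0.0813`.  Uses (E92d) `flow_nonneg_census_three_ages_young_pair`
BY NAME.  NOT CLAIMED: `k₂ ≤ 13` (R2's territory); the bounded gap; anything printed — NOT B12 Thm 2, NOT BetaPertH.

WHAT IS PROVED ([folklore]; 0 `def`, 0 sorry).  `young_pair_check`, `young_pair_slack_le`, **`flow_nonneg_census_three_ages_tail_67_100`**,
**`flow_nonneg_census_three_ages_tail_30_66`**, **`flow_nonneg_census_three_ages_tail_14_29`**, **`flow_nonneg_census_three_ages_tail_101_229`**.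
-/
noncomputable section
open Finset

namespace Summit.QuantumFields.BalabanUV.Beta.EriceRemainderEnclosureHistoryAutonomyComparisonAgeCompositionNestedYoungPairTails

open Literature.MathematicalPhysics.QuantumFieldTheory.Balaban1983to89
open Literature.MathematicalPhysics.QuantumFieldTheory.Balaban1983to89.T4BetaStationary
open Literature.MathematicalPhysics.QuantumFieldTheory.Balaban1983to89.T4BetaFlowWellPosed
open Summit.QuantumFields.BalabanUV.Beta.EriceRemainderEnclosureHistoryAutonomyComparisonAgeCompositionNestedYoungPair
  (flow_nonneg_census_three_ages_young_pair)

variable {B : (ℕ → ℝ) → ℝ} {γ b gIR : ℝ} {L : ℕ → ℝ} {K : ℕ} {h g : ℕ → ℝ}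

/-! ## Rational instances: every old tail from `k₂ ≥ 14` -/

/-- The displayed inequality of §2 from rational data: if `Q ≤ Q_U`, `K_lo ≤ k₂ ≤ K_hi`, `T ≤ k₃` and
`2·(99∕70)·Q_U·(1∕K_lo + 1∕T) + (K_hi+1)∕T ≤ (41∕140)²` (`√2 ≤ 99∕70`), then `2√2·Q·(1∕k₂ + 1∕k₃) + (k₂+1)∕k₃ ≤ (1 − √2∕2)²`. [folklore] -/
theorem young_pair_check {Q QU Klo Khi T k₂ k₃ : ℝ} (hQ0 : 0 ≤ Q) (hQ : Q ≤ QU) (hKlo : 0 < Klo) (hT : 0 < T) (hk2 : Klo ≤ k₂) (hk2' : k₂ ≤ Khi)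
    (hk3 : T ≤ k₃) (hcheck : 2 * (99 / 70) * QU * (1 / Klo + 1 / T) + (Khi + 1) / T ≤ (41 / 140) ^ 2) :
    2 * Real.sqrt 2 * Q * (1 / k₂ + 1 / k₃) + (k₂ + 1) / k₃ ≤ (1 - Real.sqrt 2 / 2) ^ 2 := by
  have hs99 : Real.sqrt 2 ≤ 99 / 70 := Real.sqrt_le_iff.mpr ⟨by norm_num, by norm_num⟩
  have hs0 : 0 ≤ Real.sqrt 2 := Real.sqrt_nonneg 2
  have hk2p : 0 < k₂ := lt_of_lt_of_le hKlo hk2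
  have hk3p : 0 < k₃ := lt_of_lt_of_le hT hk3
  have h1 : 1 / k₂ ≤ 1 / Klo := one_div_le_one_div_of_le hKlo hk2
  have h2 : 1 / k₃ ≤ 1 / T := one_div_le_one_div_of_le hT hk3
  have h3 : (k₂ + 1) / k₃ ≤ (Khi + 1) / T := by
    calc (k₂ + 1) / k₃ ≤ (Khi + 1) / k₃ := div_le_div_of_nonneg_right (by linarith) hk3p.le
      _ ≤ (Khi + 1) / T := div_le_div_of_nonneg_left (by linarith) hT hk3
  have h4 : 2 * Real.sqrt 2 * Q * (1 / k₂ + 1 / k₃) ≤ 2 * (99 / 70) * QU * (1 / Klo + 1 / T) := by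
    have ha : 2 * Real.sqrt 2 * Q ≤ 2 * (99 / 70) * QU := by nlinarith [mul_le_mul hs99 hQ hQ0 (by norm_num : (0 : ℝ) ≤ 99 / 70)]
    have hb : 1 / k₂ + 1 / k₃ ≤ 1 / Klo + 1 / T := by linarith
    exact mul_le_mul ha hb (add_nonneg (one_div_nonneg.2 hk2p.le) (one_div_nonneg.2 hk3p.le)) (by linarith [hQ0.trans hQ])
  have h5 : ((41 : ℝ) / 140) ^ 2 ≤ (1 - Real.sqrt 2 / 2) ^ 2 := pow_le_pow_left₀ (by norm_num) (by linarith) 2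
  linarith

/-- The young-pair slack `Q(p₀) = (√2∕(1+p₀) − √2∕2)∕(1 + √2∕2 − √2∕(1+p₀))` is at most `Q_U` as soon as `0 ≤ p₀ ≤ 1` and
`(99∕70)·(1 − p₀)·(1 + Q_U) ≤ 2·Q_U·(1 + p₀)`; and `Q(p₀) ≥ 0`. [folklore] -/
theorem young_pair_slack_le {p₀ QU : ℝ} (hp0 : 0 ≤ p₀) (hp1 : p₀ ≤ 1) (hQU : 0 ≤ QU)
    (hcheck : (99 / 70) * (1 - p₀) * (1 + QU) ≤ 2 * QU * (1 + p₀)) :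
    0 ≤ (Real.sqrt 2 / (1 + p₀) - Real.sqrt 2 / 2) / (1 + Real.sqrt 2 / 2 - Real.sqrt 2 / (1 + p₀))
    ∧ (Real.sqrt 2 / (1 + p₀) - Real.sqrt 2 / 2) / (1 + Real.sqrt 2 / 2 - Real.sqrt 2 / (1 + p₀)) ≤ QU := by
  have hs99 : Real.sqrt 2 ≤ 99 / 70 := Real.sqrt_le_iff.mpr ⟨by norm_num, by norm_num⟩
  have hs0 : 0 ≤ Real.sqrt 2 := Real.sqrt_nonneg 2
  have hs17 : Real.sqrt 2 ≤ 17 / 12 := Real.sqrt_le_iff.mpr ⟨by norm_num, by norm_num⟩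
  have h1p : 0 < 1 + p₀ := by linarith
  -- σ − s ≥ 0 (p₀ ≤ 1) and 1 + s − σ > 0 (σ ≤ √2 < 1 + s)
  have hnum : 0 ≤ Real.sqrt 2 / (1 + p₀) - Real.sqrt 2 / 2 := by
    have := div_le_div_of_nonneg_left hs0 h1p (show 1 + p₀ ≤ 2 by linarith)
    linarith
  have hσ2 : Real.sqrt 2 / (1 + p₀) ≤ Real.sqrt 2 := div_le_self hs0 (by linarith)
  have hden : 0 < 1 + Real.sqrt 2 / 2 - Real.sqrt 2 / (1 + p₀) := by linarith
  refine ⟨div_nonneg hnum hden.le, ?_⟩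
  rw [div_le_iff₀ hden]
  -- clear the denominator 2(1+p₀)
  have e1 : Real.sqrt 2 / (1 + p₀) - Real.sqrt 2 / 2 = Real.sqrt 2 * (1 - p₀) / (2 * (1 + p₀)) := by field_simp; ring
  have e2 : 1 + Real.sqrt 2 / 2 - Real.sqrt 2 / (1 + p₀) = (2 * (1 + p₀) - Real.sqrt 2 * (1 - p₀)) / (2 * (1 + p₀)) := by
    field_simp; ring
  rw [e1, e2, mul_div_assoc', div_le_div_iff_of_pos_right (by positivity)]
  nlinarith [mul_le_mul_of_nonneg_right hs99 (mul_nonneg (by linarith : (0 : ℝ) ≤ 1 - p₀) (by linarith : (0 : ℝ) ≤ 1 + QU))]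

/-- **EVERY OLD TAIL, `67 ≤ k₂ ≤ 100`: `k₃ ≥ 1800` ⟹ THE END** (`p₀ = 0.375`, `Q ≤ 0.475`) — the strip where neither (E92b)'s R2 (`k₂ ≤ 66`) nor (E92c)'s
nested wedge (`k₂ ≥ 81`) reached. [folklore] -/
theorem flow_nonneg_census_three_ages_tail_67_100 (hmono : ∀ u v : ℕ → ℝ, SeqBox γ u → SeqBox γ v → (∀ j, u j ≤ v j) → B u ≤ B v)
    (hL : ∀ k, 0 ≤ L k) (hb : 0 < b) (hlo : ∀ u, SeqBox γ u → b ≤ B u) (hdom : ∀ u, SeqBox γ u → ∑ k ∈ range K, L k * u k ≤ B u)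
    (hh : SeqBox γ h) (hf : MemFlow B gIR h) (hg : ∀ t, 0 < g t ∧ g t ≤ 1)
    (hgF : ∀ t, 1 ≤ g t * (1 + ∑ k ∈ range K, L k * h (t + k) ^ 3 / 2))
    {k₂ k₃ : ℕ} (hk2 : 67 ≤ k₂) (hk2' : k₂ ≤ 100) (hk3 : 1800 ≤ k₃) (hk3K : k₃ < K)
    (hL3 : ∀ j, j < K → j ≠ 1 → j ≠ k₂ → j ≠ k₃ → L j = 0)
    {N : ℕ} {KL : ℕ → ℕ → ℕ → ℝ}
    (hKL : ∀ k n l, KL k n l = if 0 < k ∧ k < K ∧ l < k then L k * h (n + k) ^ 3 / 2 * ∏ t ∈ Ico (n + 1 + l) (n + k + 1), g t else 0)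
    {KA : ℕ → ℕ → ℕ → ℝ} {RA : ℕ → (ℕ → ℝ) → ℕ → ℝ}
    (hRA : ∀ i v m, RA i v m = ∑ l ∈ range K, KA i m l * v (m + 1 + l))
    (hKA : ∀ i m l, KA i m l = KL i m l + KA (i + 1) m l) (hKAtop : ∀ m l, KA K m l = 0)
    {e ε : ℕ → ℝ} (he0 : ∀ m, 0 ≤ e m) (hea : ∀ m, e (m + 1) ≤ e m)
    (hεt : ∀ m, N < m → ε m = 0) (hεrec : ∀ m, ε m = e m - RA 1 ε m) : ∀ m, 0 ≤ ε m ∧ ε m ≤ e m := by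
  have hk2r : (67 : ℝ) ≤ k₂ := by exact_mod_cast hk2
  have hk2r' : (k₂ : ℝ) ≤ 100 := by exact_mod_cast hk2'
  have hk3r : (1800 : ℝ) ≤ k₃ := by exact_mod_cast hk3
  obtain ⟨hQ0, hQ⟩ := young_pair_slack_le (p₀ := 0.375) (QU := 0.475) (by norm_num) (by norm_num) (by norm_num) (by norm_num)
  exact flow_nonneg_census_three_ages_young_pair hmono hL hb hlo hdom hh hf hg hgF (by omega) (by omega) hk3K hL3 (p₀ := 0.375) (by norm_num)
    (by nlinarith [hk2r']) (young_pair_check hQ0 hQ (by norm_num) (by norm_num) hk2r hk2r' hk3r (by norm_num)) hKL hRA hKA hKAtop he0 hea hεt hεrec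

/-- **EVERY OLD TAIL, `30 ≤ k₂ ≤ 66`: `k₃ ≥ 1600` ⟹ THE END** (`p₀ = 0.4156`, `Q ≤ 0.414`; R2 of (E92b) starts there only between `5·10³` and `4·10⁵`).
[folklore] -/
theorem flow_nonneg_census_three_ages_tail_30_66 (hmono : ∀ u v : ℕ → ℝ, SeqBox γ u → SeqBox γ v → (∀ j, u j ≤ v j) → B u ≤ B v)
    (hL : ∀ k, 0 ≤ L k) (hb : 0 < b) (hlo : ∀ u, SeqBox γ u → b ≤ B u) (hdom : ∀ u, SeqBox γ u → ∑ k ∈ range K, L k * u k ≤ B u)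
    (hh : SeqBox γ h) (hf : MemFlow B gIR h) (hg : ∀ t, 0 < g t ∧ g t ≤ 1)
    (hgF : ∀ t, 1 ≤ g t * (1 + ∑ k ∈ range K, L k * h (t + k) ^ 3 / 2))
    {k₂ k₃ : ℕ} (hk2 : 30 ≤ k₂) (hk2' : k₂ ≤ 66) (hk3 : 1600 ≤ k₃) (hk3K : k₃ < K)
    (hL3 : ∀ j, j < K → j ≠ 1 → j ≠ k₂ → j ≠ k₃ → L j = 0)
    {N : ℕ} {KL : ℕ → ℕ → ℕ → ℝ}
    (hKL : ∀ k n l, KL k n l = if 0 < k ∧ k < K ∧ l < k then L k * h (n + k) ^ 3 / 2 * ∏ t ∈ Ico (n + 1 + l) (n + k + 1), g t else 0)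
    {KA : ℕ → ℕ → ℕ → ℝ} {RA : ℕ → (ℕ → ℝ) → ℕ → ℝ}
    (hRA : ∀ i v m, RA i v m = ∑ l ∈ range K, KA i m l * v (m + 1 + l))
    (hKA : ∀ i m l, KA i m l = KL i m l + KA (i + 1) m l) (hKAtop : ∀ m l, KA K m l = 0)
    {e ε : ℕ → ℝ} (he0 : ∀ m, 0 ≤ e m) (hea : ∀ m, e (m + 1) ≤ e m)
    (hεt : ∀ m, N < m → ε m = 0) (hεrec : ∀ m, ε m = e m - RA 1 ε m) : ∀ m, 0 ≤ ε m ∧ ε m ≤ e m := by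
  have hk2r : (30 : ℝ) ≤ k₂ := by exact_mod_cast hk2
  have hk2r' : (k₂ : ℝ) ≤ 66 := by exact_mod_cast hk2'
  have hk3r : (1600 : ℝ) ≤ k₃ := by exact_mod_cast hk3
  obtain ⟨hQ0, hQ⟩ := young_pair_slack_le (p₀ := 0.4156) (QU := 0.414) (by norm_num) (by norm_num) (by norm_num) (by norm_num)
  exact flow_nonneg_census_three_ages_young_pair hmono hL hb hlo hdom hh hf hg hgF (by omega) (by omega) hk3K hL3 (p₀ := 0.4156) (by norm_num)
    (by nlinarith [hk2r']) (young_pair_check hQ0 hQ (by norm_num) (by norm_num) hk2r hk2r' hk3r (by norm_num)) hKL hRA hKA hKAtop he0 hea hεt hεrec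

/-- **EVERY OLD TAIL, `14 ≤ k₂ ≤ 29`: `k₃ ≥ 1500` ⟹ THE END** (`p₀ = 0.508`, `Q ≤ 0.301`). [folklore] -/
theorem flow_nonneg_census_three_ages_tail_14_29 (hmono : ∀ u v : ℕ → ℝ, SeqBox γ u → SeqBox γ v → (∀ j, u j ≤ v j) → B u ≤ B v)
    (hL : ∀ k, 0 ≤ L k) (hb : 0 < b) (hlo : ∀ u, SeqBox γ u → b ≤ B u) (hdom : ∀ u, SeqBox γ u → ∑ k ∈ range K, L k * u k ≤ B u)
    (hh : SeqBox γ h) (hf : MemFlow B gIR h) (hg : ∀ t, 0 < g t ∧ g t ≤ 1)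
    (hgF : ∀ t, 1 ≤ g t * (1 + ∑ k ∈ range K, L k * h (t + k) ^ 3 / 2))
    {k₂ k₃ : ℕ} (hk2 : 14 ≤ k₂) (hk2' : k₂ ≤ 29) (hk3 : 1500 ≤ k₃) (hk3K : k₃ < K)
    (hL3 : ∀ j, j < K → j ≠ 1 → j ≠ k₂ → j ≠ k₃ → L j = 0)
    {N : ℕ} {KL : ℕ → ℕ → ℕ → ℝ}
    (hKL : ∀ k n l, KL k n l = if 0 < k ∧ k < K ∧ l < k then L k * h (n + k) ^ 3 / 2 * ∏ t ∈ Ico (n + 1 + l) (n + k + 1), g t else 0)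
    {KA : ℕ → ℕ → ℕ → ℝ} {RA : ℕ → (ℕ → ℝ) → ℕ → ℝ}
    (hRA : ∀ i v m, RA i v m = ∑ l ∈ range K, KA i m l * v (m + 1 + l))
    (hKA : ∀ i m l, KA i m l = KL i m l + KA (i + 1) m l) (hKAtop : ∀ m l, KA K m l = 0)
    {e ε : ℕ → ℝ} (he0 : ∀ m, 0 ≤ e m) (hea : ∀ m, e (m + 1) ≤ e m)
    (hεt : ∀ m, N < m → ε m = 0) (hεrec : ∀ m, ε m = e m - RA 1 ε m) : ∀ m, 0 ≤ ε m ∧ ε m ≤ e m := by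
  have hk2r : (14 : ℝ) ≤ k₂ := by exact_mod_cast hk2
  have hk2r' : (k₂ : ℝ) ≤ 29 := by exact_mod_cast hk2'
  have hk3r : (1500 : ℝ) ≤ k₃ := by exact_mod_cast hk3
  obtain ⟨hQ0, hQ⟩ := young_pair_slack_le (p₀ := 0.508) (QU := 0.301) (by norm_num) (by norm_num) (by norm_num) (by norm_num)
  exact flow_nonneg_census_three_ages_young_pair hmono hL hb hlo hdom hh hf hg hgF (by omega) (by omega) hk3K hL3 (p₀ := 0.508) (by norm_num)
    (by nlinarith [hk2r']) (young_pair_check hQ0 hQ (by norm_num) (by norm_num) hk2r hk2r' hk3r (by norm_num)) hKL hRA hKA hKAtop he0 hea hεt hεrec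

/-- **EVERY OLD TAIL, `101 ≤ k₂ ≤ 229`: `k₃ ≥ 3600` ⟹ THE END** (`p₀ = 0.3053`, `Q ≤ 0.605`; (E92c)'s nested wedge starts there between `6.5·10³` and
`3·10³`). [folklore] -/
theorem flow_nonneg_census_three_ages_tail_101_229 (hmono : ∀ u v : ℕ → ℝ, SeqBox γ u → SeqBox γ v → (∀ j, u j ≤ v j) → B u ≤ B v)
    (hL : ∀ k, 0 ≤ L k) (hb : 0 < b) (hlo : ∀ u, SeqBox γ u → b ≤ B u) (hdom : ∀ u, SeqBox γ u → ∑ k ∈ range K, L k * u k ≤ B u)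
    (hh : SeqBox γ h) (hf : MemFlow B gIR h) (hg : ∀ t, 0 < g t ∧ g t ≤ 1)
    (hgF : ∀ t, 1 ≤ g t * (1 + ∑ k ∈ range K, L k * h (t + k) ^ 3 / 2))
    {k₂ k₃ : ℕ} (hk2 : 101 ≤ k₂) (hk2' : k₂ ≤ 229) (hk3 : 3600 ≤ k₃) (hk3K : k₃ < K)
    (hL3 : ∀ j, j < K → j ≠ 1 → j ≠ k₂ → j ≠ k₃ → L j = 0)
    {N : ℕ} {KL : ℕ → ℕ → ℕ → ℝ}
    (hKL : ∀ k n l, KL k n l = if 0 < k ∧ k < K ∧ l < k then L k * h (n + k) ^ 3 / 2 * ∏ t ∈ Ico (n + 1 + l) (n + k + 1), g t else 0)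
    {KA : ℕ → ℕ → ℕ → ℝ} {RA : ℕ → (ℕ → ℝ) → ℕ → ℝ}
    (hRA : ∀ i v m, RA i v m = ∑ l ∈ range K, KA i m l * v (m + 1 + l))
    (hKA : ∀ i m l, KA i m l = KL i m l + KA (i + 1) m l) (hKAtop : ∀ m l, KA K m l = 0)
    {e ε : ℕ → ℝ} (he0 : ∀ m, 0 ≤ e m) (hea : ∀ m, e (m + 1) ≤ e m)
    (hεt : ∀ m, N < m → ε m = 0) (hεrec : ∀ m, ε m = e m - RA 1 ε m) : ∀ m, 0 ≤ ε m ∧ ε m ≤ e m := by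
  have hk2r : (101 : ℝ) ≤ k₂ := by exact_mod_cast hk2
  have hk2r' : (k₂ : ℝ) ≤ 229 := by exact_mod_cast hk2'
  have hk3r : (3600 : ℝ) ≤ k₃ := by exact_mod_cast hk3
  obtain ⟨hQ0, hQ⟩ := young_pair_slack_le (p₀ := 0.3053) (QU := 0.605) (by norm_num) (by norm_num) (by norm_num) (by norm_num)
  exact flow_nonneg_census_three_ages_young_pair hmono hL hb hlo hdom hh hf hg hgF (by omega) (by omega) hk3K hL3 (p₀ := 0.3053) (by norm_num)
    (by nlinarith [hk2r']) (young_pair_check hQ0 hQ (by norm_num) (by norm_num) hk2r hk2r' hk3r (by norm_num)) hKL hRA hKA hKAtop he0 hea hεt hεrec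

end Summit.QuantumFields.BalabanUV.Beta.EriceRemainderEnclosureHistoryAutonomyComparisonAgeCompositionNestedYoungPairTails

end
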